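import Summits.QuantumFields.YangMills.Theorems.ParabolicTrajectoryContinuumLimitOnTrajectoryDefsC

/-!
# Route `ParabolicTrajectory`, crux `ContinuumLimitOnTrajectory` (stmt-QuantumFields-10522), line `two-orbit-synchronisation`:
# renderings of the volume-growth clause ⇒ `PolyVolumeGrowth` (glue for the restatement of (A))

Helper file of the line lead (seat c3). The skeleton's quarantined stub `stub_volume : VolumeClause` (hypothesis block ⇒
`PolyVolumeGrowth sch`) is the misstatement of (A) as typed (torus-seam report `SEAM-two-orbit-synchronisation.md`); it becomes
trivial once the planner adds a volume-growth clause to (A). The three natural renderings of that clause each give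
`PolyVolumeGrowth sch` (`∃ N ≥ 1, ∀ᶠ k, a_k⁻¹ ≤ (a_k L_k)^N`):
* `polyVolumeGrowth_of_inv_le` — the linear rendering `a_k⁻¹ ≤ a_k L_k` eventually (`N = 1`);
* `polyVolumeGrowth_of_shape` — the `M`-adic rendering `M^(2 n_k) ≤ L_k` eventually under the shape `a_k = (M^{n_k})⁻¹` (`N = 1`);
* `polyVolumeGrowth_of_rpow` — the real-power rendering `a_k^{-δ} ≤ a_k L_k` eventually, `δ > 0` (`N = ⌈δ⁻¹⌉₊`; the SEAM note's
  threshold form).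
So whichever form the restated (A') carries, `VolumeClause` is discharged by one line and the tree theorem
`continuumLimitOnTrajectory_of_inputsCS` (…Reduction2) yields `ChartExists → IRPhysicsCS → UVPhysics345 → (A')`. [folklore]
-/

set_option autoImplicit false

open Filter Topology
open Literature.MathematicalPhysics.QuantumFieldTheory

noncomputable section

namespace Summit.QuantumFields.YangMills.Cruxes.ContinuumLimitOnTrajectory.TwoOrbitSynchronisation

/-- The linear rendering `a_k⁻¹ ≤ a_k L_k` eventually gives `PolyVolumeGrowth` with `N = 1`. -/
theorem polyVolumeGrowth_of_inv_le {ι : Type} (sch : SpeciesScheme ι)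
    (h : ∀ᶠ k in atTop, (sch.a k)⁻¹ ≤ sch.a k * (sch.L k : ℝ)) : PolyVolumeGrowth sch :=
  ⟨1, le_rfl, h.mono fun k hk => by rwa [pow_one]⟩

/-- The `M`-adic rendering `M^(2 n_k) ≤ L_k` eventually (shape `a_k = (M^{n_k})⁻¹`) gives `PolyVolumeGrowth` with `N = 1`. -/
theorem polyVolumeGrowth_of_shape {ι : Type} (sch : SpeciesScheme ι) {M : ℕ} {n : ℕ → ℕ}
    (hshape : ∀ k, sch.a k = ((M : ℝ) ^ n k)⁻¹) (h : ∀ᶠ k in atTop, M ^ (2 * n k) ≤ sch.L k) :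
    PolyVolumeGrowth sch := by
  refine polyVolumeGrowth_of_inv_le sch (h.mono fun k hk => ?_)
  have hM : (0 : ℝ) < (M : ℝ) ^ n k := by
    have := sch.a_pos k
    rw [hshape k, inv_pos] at this
    exact this
  rw [hshape k, inv_inv]
  have hk' : ((M : ℝ) ^ n k) ^ 2 ≤ (sch.L k : ℝ) := by
    rw [← pow_mul, mul_comm]
    exact_mod_cast hk
  rw [le_inv_mul_iff₀ hM]
  nlinarith [hk']

/-- The real-power rendering `a_k^{-δ} ≤ a_k L_k` eventually, `δ > 0`, gives `PolyVolumeGrowth` with `N = ⌈δ⁻¹⌉₊`. -/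
theorem polyVolumeGrowth_of_rpow :
    ∀ {ι : Type} (sch : SpeciesScheme ι) {δ : ℝ}, 0 < δ →
      (∀ᶠ k in atTop, (sch.a k) ^ (-δ) ≤ sch.a k * (sch.L k : ℝ)) → PolyVolumeGrowth sch := by
  intro ι sch δ hδ h
  refine ⟨⌈δ⁻¹⌉₊, Nat.one_le_iff_ne_zero.2 (by positivity), ?_⟩
  have ha1 : ∀ᶠ k in atTop, sch.a k ≤ 1 := (sch.tendsto_a.eventually_le_const one_pos).mono fun k hk => hk
  filter_upwards [h, ha1] with k hk hk1
  have ha : 0 < sch.a k := sch.a_pos k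
  have hN : δ⁻¹ ≤ (⌈δ⁻¹⌉₊ : ℝ) := Nat.le_ceil _
  have h1 : 1 ≤ δ * (⌈δ⁻¹⌉₊ : ℝ) := by
    calc (1 : ℝ) = δ * δ⁻¹ := by field_simp
      _ ≤ δ * (⌈δ⁻¹⌉₊ : ℝ) := by gcongr
  have hpos : 0 < (sch.a k) ^ (-δ) := Real.rpow_pos_of_pos ha _
  calc (sch.a k)⁻¹ = (sch.a k) ^ (-(1 : ℝ)) := by rw [Real.rpow_neg ha.le, Real.rpow_one]
    _ ≤ (sch.a k) ^ (-(δ * (⌈δ⁻¹⌉₊ : ℝ))) := by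
        apply Real.rpow_le_rpow_of_exponent_ge ha hk1
        linarith
    _ = ((sch.a k) ^ (-δ)) ^ (⌈δ⁻¹⌉₊ : ℕ) := by
        rw [← Real.rpow_natCast, ← Real.rpow_mul ha.le]; ring_nf
    _ ≤ (sch.a k * (sch.L k : ℝ)) ^ ⌈δ⁻¹⌉₊ := by gcongr

end Summit.QuantumFields.YangMills.Cruxes.ContinuumLimitOnTrajectory.TwoOrbitSynchronisation

end
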